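import Summits.AtomisticToContinuum.Crystallization.Theorems.FrustratedLawDichotomyStrainedPatchHomCurvCoeff3
import Summits.AtomisticToContinuum.Crystallization.Theorems.FrustratedLawDichotomyStrainedPatchHomCurvDispatch2
import Summits.AtomisticToContinuum.Crystallization.Theorems.FrustratedLawDichotomyStrainedPatchHomCurvCentre
import Summits.AtomisticToContinuum.Crystallization.Theorems.FrustratedLawDichotomyStrainedPatchHomCoords

/-!
# Kernel kit of the CENTRED curvature leaf: per-label centre point, displacement enclosure, tube, regime flags and coefficient data

decomp-a2c hand-1 g27 (crux `AperiodicFrustratedLawGap`, stmt-AtomisticToContinuum-27623; `(H) HomFloor (1/625)`, hcp half; lever (C); hand-1 g27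
FINDING «loss budget»).  For a box `(c, w)` (entries of `U` under `Sum.inl`, shuffle under `Sum.inr`, scale `SC`) and a `B`-label `b`, the centred
leaf expands the label's curvature form around the BOX-CENTRE point `p_b = latPt U_c hexFrame b + U_c(hcpShift + η_c)` (`U_c`, `η_c` = the centre
data read as a self-map / shuffle: `cenMap`, `cenShuf`).  This file computes, in the kernel:

* §1 `cenMap`, `cenShuf` (real objects of the integer centre) and their zero-width box memberships;
* §2 `mulVecFI`, `cenVec` ∋ `p_b`, `wVec` ∋ `w_b = latPt 1 hexFrame b + (hcpShift + η_c)`, `dVec` ∋ `d_b = c_b − p_b = (U − U_c)w_b + U(η − η_c)`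
  (`…HomCurvCentre.labelPoint_sub_eq`), `uBound` ≥ `|(U(η − η_c))_k|·SC`, `nd2S` ≥ `‖d_b‖²·SC`, `ndS` ≥ `‖d_b‖·SC`;
* §3 `rho0`, `tube = [ρ₀.lo − ndS − 1, ρ₀.hi + ndS + 1]` (STRICTLY contains every `‖p_b + t d_b‖`, `t ∈ [0,1]`), regime flags `regBump / regLJ`
  (exact integer comparisons with `8/5`, `3`), `tripleAt` (the `(α, α′ρ, α″ρ²)` enclosure of the flagged regime);
* §4 `CenLabel` / `cenLabel c w b` — the per-label record (centre vector, `w_b`, `α(ρ₀)`, `β(ρ₀)`, `α′(ρ₀)/ρ₀`, remainder constant `KS`, `nd2S`),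
  `Dreal` / `Darr` (the first-order arrays `(∂_kh)_ij = a₁p_kp_ip_j + α(δ_ik p_j + δ_jk p_i) + αp_kδ_ij` and their enclosure).

Kernel definitions + atomic soundness lemmas; 0 sorry; standard axioms; no instances / notation / `#eval`.  `--supports stmt-AtomisticToContinuum-27623`.
-/

noncomputable section

namespace Summit.AtomisticToContinuum.Crystallization.Theorems.FrustratedLawDichotomyStrainedPatchHomCurvCentreKit

open scoped BigOperators RealInnerProductSpace
open Literature.Analysis.ValidatedNumerics.Numerics
open Summit.AtomisticToContinuum.Crystallization.Theorems.ChargedEnergyGapNegative (E3)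
open Summit.AtomisticToContinuum.Crystallization.Theorems.FrustratedLawDichotomyStrainedPatchHomSplit (latPt hexFrame hcpShift)
open Summit.AtomisticToContinuum.Crystallization.Theorems.FrustratedLawDichotomyStrainedPatchHomEntryGram (entryFI mem_entryFI)
open Summit.AtomisticToContinuum.Crystallization.Theorems.FrustratedLawDichotomyStrainedPatchHomEntryGramHcp (dot3 shufFI mem_dot3 mem_shufFI)
open Summit.AtomisticToContinuum.Crystallization.Theorems.FrustratedLawDichotomyStrainedPatchHomForceKit (vecB mem_vecB cId)
open Summit.AtomisticToContinuum.Crystallization.Theorems.FrustratedLawDichotomyStrainedPatchHomCoords (apply_eq_sum_entries)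
open Summit.AtomisticToContinuum.Crystallization.Theorems.FrustratedLawDichotomyStrainedPatchHomCurvCoeff (wFI coeffFI2 rhoFI mem_rhoFI)
open Summit.AtomisticToContinuum.Crystallization.Theorems.FrustratedLawDichotomyStrainedPatchHomCurvCoeff3 (ljTripleFI bumpTripleFI kTermS)
open Summit.AtomisticToContinuum.Crystallization.Theorems.FrustratedLawDichotomyStrainedPatchHomCurvCentre (labelPoint_sub_eq norm_sq_le_of_abs_le)

/-! ## §1. The centre self-map and centre shuffle -/

/-- Zero half-widths. -/
def zW : (Fin 3 × Fin 3) ⊕ Fin 3 → ℤ := fun _ => 0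

/-- The real `3 × 3` matrix of the box-centre entries `c_kl/SC`. -/
def cenMat (c : (Fin 3 × Fin 3) ⊕ Fin 3 → ℤ) : Matrix (Fin 3) (Fin 3) ℝ := fun k l => (c (Sum.inl (k, l)) : ℝ) / SC

/-- The box-centre self-map `U_c`. -/
def cenMap (c : (Fin 3 × Fin 3) ⊕ Fin 3 → ℤ) : E3 →L[ℝ] E3 := LinearMap.toContinuousLinearMap (Matrix.toEuclideanLin (cenMat c))

/-- The box-centre shuffle `η_c`. -/
def cenShuf (c : (Fin 3 × Fin 3) ⊕ Fin 3 → ℤ) : E3 := (EuclideanSpace.equiv (Fin 3) ℝ).symm fun i => (c (Sum.inr i) : ℝ) / SC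

/-- `(U_c x)_k = Σ_l (c_kl/SC) x_l`. [formal bookkeeping] -/
theorem cenMap_apply (c : (Fin 3 × Fin 3) ⊕ Fin 3 → ℤ) (x : E3) (k : Fin 3) :
    cenMap c x k = ∑ l : Fin 3, (c (Sum.inl (k, l)) : ℝ) / SC * x l := by
  simp [cenMap, cenMat, Matrix.toLpLin_apply, Matrix.mulVec, dotProduct]

/-- The entries of `U_c` are `c_kl/SC`. [formal bookkeeping] -/
theorem cenMap_entry (c : (Fin 3 × Fin 3) ⊕ Fin 3 → ℤ) (k l : Fin 3) :
    (cenMap c (EuclideanSpace.single l (1 : ℝ))) k = (c (Sum.inl (k, l)) : ℝ) / SC := by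
  rw [cenMap_apply]
  simp

/-- `η_c` components. [formal bookkeeping] -/
theorem cenShuf_apply (c : (Fin 3 × Fin 3) ⊕ Fin 3 → ℤ) (i : Fin 3) : cenShuf c i = (c (Sum.inr i) : ℝ) / SC := rfl

/-- `U_c` lies in the zero-width entry box at the centre. [formal bookkeeping] -/
theorem cenMap_box (c : (Fin 3 × Fin 3) ⊕ Fin 3 → ℤ) (ab : Fin 3 × Fin 3) :
    |(cenMap c (EuclideanSpace.single ab.2 (1 : ℝ))) ab.1 - (c (Sum.inl ab) : ℝ) / SC| ≤ ((0 : ℤ) : ℝ) / SC := by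
  rw [cenMap_entry]; simp

/-- `η_c` lies in the zero-width shuffle box at the centre. [formal bookkeeping] -/
theorem cenShuf_box (c : (Fin 3 × Fin 3) ⊕ Fin 3 → ℤ) (i : Fin 3) :
    |cenShuf c i - (c (Sum.inr i) : ℝ) / SC| ≤ ((zW (Sum.inr i) : ℤ) : ℝ) / SC := by
  rw [cenShuf_apply]; simp [zW]

/-! ## §2. Interval data: entries, centre vector, `w_b`, displacement -/

/-- Entry box. -/
def boxE (c w : (Fin 3 × Fin 3) ⊕ Fin 3 → ℤ) : Fin 3 × Fin 3 → FI := entryFI (fun ab => c (Sum.inl ab)) (fun ab => w (Sum.inl ab))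
/-- Zero-width entry box at the centre. -/
def cenE (c : (Fin 3 × Fin 3) ⊕ Fin 3 → ℤ) : Fin 3 × Fin 3 → FI := entryFI (fun ab => c (Sum.inl ab)) (fun _ => 0)
/-- Entry box of `U − U_c` (centre `0`, the box half-widths). -/
def difE (w : (Fin 3 × Fin 3) ⊕ Fin 3 → ℤ) : Fin 3 × Fin 3 → FI := entryFI (fun _ => 0) (fun ab => w (Sum.inl ab))
/-- Zero-width entry box of the identity. -/
def idE : Fin 3 × Fin 3 → FI := entryFI cId (fun _ => 0)
/-- Zero-width shuffle box at the centre. -/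
def cenX (c : (Fin 3 × Fin 3) ⊕ Fin 3 → ℤ) : Fin 3 → FI := shufFI c zW
/-- Shuffle box of `η − η_c` (centre `0`). -/
def difX (w : (Fin 3 × Fin 3) ⊕ Fin 3 → ℤ) : Fin 3 → FI := shufFI zW w

/-- `Σ_l E(a,l)·Y_l`: matrix–vector product in the kernel. -/
def mulVecFI (E : Fin 3 × Fin 3 → FI) (Y : Fin 3 → FI) (a : Fin 3) : FI :=
  (((E (a, 0)).mul (Y 0)).add ((E (a, 1)).mul (Y 1))).add ((E (a, 2)).mul (Y 2))

/-- `mulVecFI` encloses `(U y)_a`. [folklore] -/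
theorem mem_mulVecFI (U : E3 →L[ℝ] E3) (y : E3) {E : Fin 3 × Fin 3 → FI} {Y : Fin 3 → FI}
    (hE : ∀ ab : Fin 3 × Fin 3, FI.mem ((U (EuclideanSpace.single ab.2 (1 : ℝ))) ab.1) (E ab)) (hY : ∀ l, FI.mem (y l) (Y l)) (a : Fin 3) :
    FI.mem ((U y) a) (mulVecFI E Y a) := by
  rw [apply_eq_sum_entries, Fin.sum_univ_three]
  exact FI.mem_add (FI.mem_add (FI.mem_mul (hE (a, 0)) (hY 0)) (FI.mem_mul (hE (a, 1)) (hY 1))) (FI.mem_mul (hE (a, 2)) (hY 2))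

/-- Centre vector `p_b` in the kernel. -/
def cenVec (c : (Fin 3 × Fin 3) ⊕ Fin 3 → ℤ) (b : Fin 3 → ℤ) : Fin 3 → FI := vecB (cenE c) (cenX c) b
/-- `w_b = latPt 1 hexFrame b + (hcpShift + η_c)` in the kernel. -/
def wVec (c : (Fin 3 × Fin 3) ⊕ Fin 3 → ℤ) (b : Fin 3 → ℤ) : Fin 3 → FI := vecB idE (cenX c) b
/-- Displacement `d_b = (U − U_c)w_b + U(η − η_c)` in the kernel. -/
def dVec (c w : (Fin 3 × Fin 3) ⊕ Fin 3 → ℤ) (b : Fin 3 → ℤ) (a : Fin 3) : FI := (vecB (difE w) (cenX c) b a).add (mulVecFI (boxE c w) (difX w) a)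
/-- Scaled bound of `|(U(η − η_c))_k|`. -/
def uBound (c w : (Fin 3 × Fin 3) ⊕ Fin 3 → ℤ) (k : Fin 3) : ℤ := (mulVecFI (boxE c w) (difX w) k).absHi
/-- Scaled bound of `‖d_b‖²`: `cdiv (Σ_k absHi(d_k)²) SC`. -/
def nd2S (c w : (Fin 3 × Fin 3) ⊕ Fin 3 → ℤ) (b : Fin 3 → ℤ) : ℤ := cdiv (∑ k : Fin 3, (dVec c w b k).absHi ^ 2) SC
/-- Scaled bound of `‖d_b‖`. -/
def ndS (c w : (Fin 3 × Fin 3) ⊕ Fin 3 → ℤ) (b : Fin 3 → ℤ) : ℤ := (FI.sqrt ⟨0, nd2S c w b⟩).hi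

/-- The real centre point `p_b`. -/
def cenPt (c : (Fin 3 × Fin 3) ⊕ Fin 3 → ℤ) (b : Fin 3 → ℤ) : E3 := latPt (cenMap c) hexFrame b + cenMap c (hcpShift + cenShuf c)
/-- The real vector `w_b`. -/
def wPt (c : (Fin 3 × Fin 3) ⊕ Fin 3 → ℤ) (b : Fin 3 → ℤ) : E3 := latPt (1 : E3 →L[ℝ] E3) hexFrame b + (hcpShift + cenShuf c)

/-- ★ `cenVec` encloses `p_b`. [folklore chaining] -/
theorem mem_cenVec (c : (Fin 3 × Fin 3) ⊕ Fin 3 → ℤ) (b : Fin 3 → ℤ) (a : Fin 3) : FI.mem (cenPt c b a) (cenVec c b a) :=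
  mem_vecB (cenMap c) (cenShuf c) (fun ab => mem_entryFI (cenMap_box c ab)) (fun i => mem_shufFI (cenShuf_box c i)) b a

/-- ★ `wVec` encloses `w_b`. [folklore chaining] -/
theorem mem_wVec (c : (Fin 3 × Fin 3) ⊕ Fin 3 → ℤ) (b : Fin 3 → ℤ) (a : Fin 3) : FI.mem (wPt c b a) (wVec c b a) := by
  have hI : ∀ ab : Fin 3 × Fin 3, FI.mem (((1 : E3 →L[ℝ] E3) (EuclideanSpace.single ab.2 (1 : ℝ))) ab.1) (idE ab) := by
    rintro ⟨k, l⟩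
    refine mem_entryFI ?_
    have hS : (SC : ℝ) ≠ 0 := by norm_num [SC]
    by_cases h : k = l
    · subst h
      have e : ((1 : E3 →L[ℝ] E3) (EuclideanSpace.single k (1 : ℝ))) k = 1 := by simp
      rw [e]; simp [cId, hS]
    · have e : ((1 : E3 →L[ℝ] E3) (EuclideanSpace.single l (1 : ℝ))) k = 0 := by simp [h]
      rw [e]; simp [cId, h]
  have h := mem_vecB (1 : E3 →L[ℝ] E3) (cenShuf c) hI (fun i => mem_shufFI (cenShuf_box c i)) b a
  unfold wVec cenX wPt
  simpa using h

/-- ★ `dVec` encloses the displacement `c_b − p_b` of the label point over the box. [folklore chaining: `…HomCurvCentre.labelPoint_sub_eq`] -/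
theorem mem_dVec {c w : (Fin 3 × Fin 3) ⊕ Fin 3 → ℤ} (U : E3 →L[ℝ] E3)
    (hbox : ∀ ab : Fin 3 × Fin 3, |(U (EuclideanSpace.single ab.2 (1 : ℝ))) ab.1 - (c (Sum.inl ab) : ℝ) / SC| ≤ (w (Sum.inl ab) : ℝ) / SC)
    (η : E3) (hη : ∀ i : Fin 3, |η i - (c (Sum.inr i) : ℝ) / SC| ≤ (w (Sum.inr i) : ℝ) / SC) (b : Fin 3 → ℤ) (a : Fin 3) :
    FI.mem ((latPt U hexFrame b + U (hcpShift + η) - cenPt c b) a) (dVec c w b a) := by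
  rw [cenPt, labelPoint_sub_eq, PiLp.add_apply]
  refine FI.mem_add ?_ ?_
  · refine mem_vecB (U - cenMap c) (cenShuf c) (fun ab => mem_entryFI ?_) (fun i => mem_shufFI (cenShuf_box c i)) b a
    rw [show ((U - cenMap c) (EuclideanSpace.single ab.2 (1 : ℝ))) ab.1 =
        (U (EuclideanSpace.single ab.2 (1 : ℝ))) ab.1 - (cenMap c (EuclideanSpace.single ab.2 (1 : ℝ))) ab.1 from rfl, cenMap_entry]
    simpa using hbox ab
  · refine mem_mulVecFI U (η - cenShuf c) (fun ab => mem_entryFI (hbox ab)) (fun l => mem_shufFI ?_) a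
    rw [PiLp.sub_apply, cenShuf_apply]
    simpa [zW] using hη l

/-- The components of the displacement: `d_k = Σ_l (U_kl − c_kl/SC)(w_b)_l + (U(η − η_c))_k`. [arithmetic] -/
theorem dVec_formula (c : (Fin 3 × Fin 3) ⊕ Fin 3 → ℤ) (U : E3 →L[ℝ] E3) (η : E3) (b : Fin 3 → ℤ) (k : Fin 3) :
    (latPt U hexFrame b + U (hcpShift + η) - cenPt c b) k =
      ∑ l : Fin 3, ((U (EuclideanSpace.single l (1 : ℝ))) k - (c (Sum.inl (k, l)) : ℝ) / SC) * wPt c b l + (U (η - cenShuf c)) k := by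
  rw [cenPt, labelPoint_sub_eq, PiLp.add_apply]
  congr 1
  have hw : latPt (U - cenMap c) hexFrame b + (U - cenMap c) (hcpShift + cenShuf c) = (U - cenMap c) (wPt c b) := by
    simp [wPt, latPt, map_add]
  rw [hw, apply_eq_sum_entries]
  refine Finset.sum_congr rfl fun l _ => ?_
  rw [show ((U - cenMap c) (EuclideanSpace.single l (1 : ℝ))) k =
      (U (EuclideanSpace.single l (1 : ℝ))) k - (cenMap c (EuclideanSpace.single l (1 : ℝ))) k from rfl, cenMap_entry]

/-- `|(U(η − η_c))_k|·SC ≤ uBound`. [folklore] -/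
theorem abs_shift_le {c w : (Fin 3 × Fin 3) ⊕ Fin 3 → ℤ} (U : E3 →L[ℝ] E3)
    (hbox : ∀ ab : Fin 3 × Fin 3, |(U (EuclideanSpace.single ab.2 (1 : ℝ))) ab.1 - (c (Sum.inl ab) : ℝ) / SC| ≤ (w (Sum.inl ab) : ℝ) / SC)
    (η : E3) (hη : ∀ i : Fin 3, |η i - (c (Sum.inr i) : ℝ) / SC| ≤ (w (Sum.inr i) : ℝ) / SC) (k : Fin 3) :
    |(U (η - cenShuf c)) k| * SC ≤ (uBound c w k : ℝ) := by
  refine FI.abs_le_absHi (mem_mulVecFI U (η - cenShuf c) (fun ab => mem_entryFI (hbox ab)) (fun l => mem_shufFI ?_) k)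
  rw [PiLp.sub_apply, cenShuf_apply]
  simpa [zW] using hη l

/-- `‖d_b‖²·SC ≤ nd2S` (from the componentwise `absHi`). [folklore] -/
theorem norm_sq_dVec_le {c w : (Fin 3 × Fin 3) ⊕ Fin 3 → ℤ} (U : E3 →L[ℝ] E3)
    (hbox : ∀ ab : Fin 3 × Fin 3, |(U (EuclideanSpace.single ab.2 (1 : ℝ))) ab.1 - (c (Sum.inl ab) : ℝ) / SC| ≤ (w (Sum.inl ab) : ℝ) / SC)
    (η : E3) (hη : ∀ i : Fin 3, |η i - (c (Sum.inr i) : ℝ) / SC| ≤ (w (Sum.inr i) : ℝ) / SC) (b : Fin 3 → ℤ) :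
    ‖latPt U hexFrame b + U (hcpShift + η) - cenPt c b‖ ^ 2 * SC ≤ (nd2S c w b : ℝ) := by
  have hS : (0 : ℝ) < SC := by norm_num [SC]
  set d := latPt U hexFrame b + U (hcpShift + η) - cenPt c b with hd
  have hk : ∀ k, |d k| ≤ ((dVec c w b k).absHi : ℝ) / SC := fun k => by
    rw [le_div_iff₀ hS]; exact FI.abs_le_absHi (mem_dVec U hbox η hη b k)
  have h1 := norm_sq_le_of_abs_le d _ hk
  have h2 : (∑ k : Fin 3, (((dVec c w b k).absHi : ℝ) / SC) ^ 2) * SC = (∑ k : Fin 3, ((dVec c w b k).absHi : ℝ) ^ 2) / SC := by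
    rw [Finset.sum_mul, Finset.sum_div]
    exact Finset.sum_congr rfl fun k _ => by field_simp
  have h3 : (∑ k : Fin 3, ((dVec c w b k).absHi : ℝ) ^ 2) / SC ≤ (nd2S c w b : ℝ) := by
    have := div_le_cdiv (a := ∑ k : Fin 3, (dVec c w b k).absHi ^ 2) (b := (SC : ℤ)) (by exact_mod_cast hS)
    push_cast at this
    exact this
  calc ‖d‖ ^ 2 * SC ≤ (∑ k : Fin 3, (((dVec c w b k).absHi : ℝ) / SC) ^ 2) * SC := mul_le_mul_of_nonneg_right h1 hS.le
    _ = _ := h2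
    _ ≤ _ := h3

/-- `‖d_b‖·SC ≤ ndS`. [folklore] -/
theorem norm_dVec_le {c w : (Fin 3 × Fin 3) ⊕ Fin 3 → ℤ} (U : E3 →L[ℝ] E3)
    (hbox : ∀ ab : Fin 3 × Fin 3, |(U (EuclideanSpace.single ab.2 (1 : ℝ))) ab.1 - (c (Sum.inl ab) : ℝ) / SC| ≤ (w (Sum.inl ab) : ℝ) / SC)
    (η : E3) (hη : ∀ i : Fin 3, |η i - (c (Sum.inr i) : ℝ) / SC| ≤ (w (Sum.inr i) : ℝ) / SC) (b : Fin 3 → ℤ) :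
    ‖latPt U hexFrame b + U (hcpShift + η) - cenPt c b‖ * SC ≤ (ndS c w b : ℝ) := by
  set d := latPt U hexFrame b + U (hcpShift + η) - cenPt c b with hd
  have hmem : FI.mem (‖d‖ ^ 2) ⟨0, nd2S c w b⟩ := by
    refine ⟨?_, ?_⟩
    · push_cast; positivity
    · exact norm_sq_dVec_le U hbox η hη b
  have hs := FI.mem_sqrt hmem
  rw [Real.sqrt_sq (norm_nonneg _)] at hs
  exact hs.2

/-! ## §3. Centre radius, tube, regime flags -/

/-- The centre radius `ρ₀ = ‖p_b‖` in the kernel. -/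
def rho0 (c : (Fin 3 × Fin 3) ⊕ Fin 3 → ℤ) (b : Fin 3 → ℤ) : FI := rhoFI (dot3 (cenVec c b) (cenVec c b))

/-- The tube interval (with one-ulp margins): every `‖p_b + t d_b‖`, `t ∈ [0,1]`, lies STRICTLY inside. -/
def tube (c w : (Fin 3 × Fin 3) ⊕ Fin 3 → ℤ) (b : Fin 3 → ℤ) : FI := ⟨(rho0 c b).lo - ndS c w b - 1, (rho0 c b).hi + ndS c w b + 1⟩

/-- The tube lies inside the bump regime `(0, 8/5)`. -/
def regBump (T : FI) : Bool := decide (0 < T.lo ∧ 5 * T.hi < 8 * (SC : ℤ))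
/-- The tube lies inside the Lennard-Jones regime `(8/5, 3)`. -/
def regLJ (T : FI) : Bool := decide (8 * (SC : ℤ) < 5 * T.lo ∧ T.hi < 3 * (SC : ℤ))

/-- The `(α, α′ρ, α″ρ²)` enclosure of the regime flagged by `T`, over the radius data `(Q ∋ ρ², W ∋ 5ρ/4)`. -/
def tripleAt (T Q W : FI) : Option (FI × FI × FI) := if regBump T then bumpTripleFI Q W else if regLJ T then ljTripleFI Q else none

/-- `‖p_b‖² ∈ dot3 cenVec cenVec` and `‖p_b‖ ∈ rho0`. [folklore chaining] -/
theorem mem_rho0 (c : (Fin 3 × Fin 3) ⊕ Fin 3 → ℤ) (b : Fin 3 → ℤ) :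
    FI.mem (‖cenPt c b‖ ^ 2) (dot3 (cenVec c b) (cenVec c b)) ∧ FI.mem ‖cenPt c b‖ (rho0 c b) := by
  have hq : FI.mem (‖cenPt c b‖ ^ 2) (dot3 (cenVec c b) (cenVec c b)) := by
    rw [← real_inner_self_eq_norm_sq]; exact mem_dot3 (mem_cenVec c b) (mem_cenVec c b)
  exact ⟨hq, mem_rhoFI (norm_nonneg _) hq⟩

/-- ★ **The tube contains the path**: for `U, η` in the box and `t ∈ [0,1]`, `tube.lo/SC < ‖p_b + t d_b‖ < tube.hi/SC`. [folklore] -/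
theorem tube_mem {c w : (Fin 3 × Fin 3) ⊕ Fin 3 → ℤ} (U : E3 →L[ℝ] E3)
    (hbox : ∀ ab : Fin 3 × Fin 3, |(U (EuclideanSpace.single ab.2 (1 : ℝ))) ab.1 - (c (Sum.inl ab) : ℝ) / SC| ≤ (w (Sum.inl ab) : ℝ) / SC)
    (η : E3) (hη : ∀ i : Fin 3, |η i - (c (Sum.inr i) : ℝ) / SC| ≤ (w (Sum.inr i) : ℝ) / SC) (b : Fin 3 → ℤ) {t : ℝ} (ht : t ∈ Set.Icc (0 : ℝ) 1) :
    ((tube c w b).lo : ℝ) / SC < ‖cenPt c b + t • (latPt U hexFrame b + U (hcpShift + η) - cenPt c b)‖ ∧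
      ‖cenPt c b + t • (latPt U hexFrame b + U (hcpShift + η) - cenPt c b)‖ < ((tube c w b).hi : ℝ) / SC := by
  have hS : (0 : ℝ) < SC := by norm_num [SC]
  set p := cenPt c b with hp
  set d := latPt U hexFrame b + U (hcpShift + η) - cenPt c b with hd
  have hρ := (mem_rho0 c b).2
  have hlo : ((rho0 c b).lo : ℝ) ≤ ‖p‖ * SC := hρ.1
  have hhi : ‖p‖ * SC ≤ ((rho0 c b).hi : ℝ) := hρ.2
  have hdn : ‖d‖ * SC ≤ (ndS c w b : ℝ) := norm_dVec_le U hbox η hη b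
  have htd : ‖t • d‖ ≤ ‖d‖ := by
    rw [norm_smul, Real.norm_eq_abs, abs_of_nonneg ht.1]; exact mul_le_of_le_one_left (norm_nonneg _) ht.2
  have h1 : ‖p‖ - ‖d‖ ≤ ‖p + t • d‖ := by
    have := norm_sub_norm_le p (-(t • d))
    rw [sub_neg_eq_add, norm_neg] at this
    linarith [abs_le.1 (abs_norm_sub_norm_le p (p + t • d))]
  have h1' : ‖p‖ - ‖d‖ ≤ ‖p + t • d‖ := by
    have := norm_le_norm_add_norm_sub' p (p + t • d)
    have e : p - (p + t • d) = -(t • d) := by abel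
    rw [e, norm_neg] at this
    linarith
  have h2 : ‖p + t • d‖ ≤ ‖p‖ + ‖d‖ := (norm_add_le _ _).trans (by linarith)
  simp only [tube]
  push_cast
  constructor
  · rw [div_lt_iff₀ hS]; nlinarith
  · rw [lt_div_iff₀ hS]; nlinarith

/-! ## §4. The per-label record and the first-order arrays -/

/-- Per-label data of a centred label: centre vector `P ∋ p_b`, `Wv ∋ w_b`, `A0 ∋ α(ρ₀)`, `B0 ∋ β(ρ₀)`, `A1q ∋ α′(ρ₀)/ρ₀`, remainder constant `KS`
(`≥ SC·K` of `pathForm_secondOrder` on the tube), `nd2 ≥ SC·‖d_b‖²`. -/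
structure CenLabel where
  /-- centre vector components -/
  P : Fin 3 → FI
  /-- `w_b` components -/
  Wv : Fin 3 → FI
  /-- `α(ρ₀)` -/
  A0 : FI
  /-- `β(ρ₀)` -/
  B0 : FI
  /-- `α′(ρ₀)/ρ₀` -/
  A1q : FI
  /-- scaled remainder constant -/
  KS : ℤ
  /-- scaled `‖d_b‖²` bound -/
  nd2 : ℤ

/-- ★ **The per-label computation** (`none` = the label cannot be centred: tube not inside bump/LJ, or an enclosure failed). -/
def cenLabel (c w : (Fin 3 × Fin 3) ⊕ Fin 3 → ℤ) (b : Fin 3 → ℤ) : Option CenLabel :=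
  let P := cenVec c b
  let Q0 := dot3 P P
  let T := tube c w b
  match tripleAt T (T.mul T) (wFI T), tripleAt T Q0 (wFI (rhoFI Q0)), coeffFI2 Q0 with
  | some tt, some t0, some ab =>
    match FI.divPos t0.2.1 Q0 with
    | some a1q => some ⟨P, wVec c b, ab.1, ab.2, a1q, kTermS tt.1 tt.2.1 tt.2.2, nd2S c w b⟩
    | none => none
  | _, _, _ => none

/-- The real first-order array `(∂_kh)_ij = a₁ p_k p_i p_j + α(δ_ik p_j + δ_jk p_i) + α p_k δ_ij`. -/
def Dreal (a₁ α₀ : ℝ) (p : E3) (k i j : Fin 3) : ℝ :=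
  a₁ * (p k * (p i * p j)) + (if i = k then α₀ * p j else 0) + (if j = k then α₀ * p i else 0) + (if i = j then α₀ * p k else 0)

/-- Its kernel enclosure from the label record. -/
def Darr (L : CenLabel) (k i j : Fin 3) : FI :=
  (((L.A1q.mul ((L.P k).mul ((L.P i).mul (L.P j)))).add (if i = k then L.A0.mul (L.P j) else FI.ofInt 0)).add
    (if j = k then L.A0.mul (L.P i) else FI.ofInt 0)).add (if i = j then L.A0.mul (L.P k) else FI.ofInt 0)

/-- ★ `Darr` encloses `Dreal`. [folklore] -/
theorem mem_Darr {L : CenLabel} {a₁ α₀ : ℝ} {p : E3} (h1 : FI.mem a₁ L.A1q) (h0 : FI.mem α₀ L.A0) (hp : ∀ a, FI.mem (p a) (L.P a))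
    (k i j : Fin 3) : FI.mem (Dreal a₁ α₀ p k i j) (Darr L k i j) := by
  have hz : FI.mem (0 : ℝ) (FI.ofInt 0) := by simpa using FI.mem_ofInt 0
  unfold Dreal Darr
  refine FI.mem_add (FI.mem_add (FI.mem_add (FI.mem_mul h1 (FI.mem_mul (hp k) (FI.mem_mul (hp i) (hp j)))) ?_) ?_) ?_
  · split_ifs
    · exact FI.mem_mul h0 (hp j)
    · exact hz
  · split_ifs
    · exact FI.mem_mul h0 (hp i)
    · exact hz
  · split_ifs
    · exact FI.mem_mul h0 (hp k)
    · exact hz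

end Summit.AtomisticToContinuum.Crystallization.Theorems.FrustratedLawDichotomyStrainedPatchHomCurvCentreKit

end
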